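/-
Copyright: publication-cell `pub-balaban` (b2b), seat b2b-balaban-b10 gen 20 (v1).  Literature leaf — the algebra and
elementary analysis of the exponential map in a unital C⋆-algebra (an interaction-picture Grönwall estimate; the polar
decomposition through the real continuous functional calculus), one-variable complex differentiability and real
arithmetic only; every theorem is kernel-proved and tagged [folklore] or [cite: …] (a LOCATED printed shape); the
objects are the MODEL OBJECTS of `…B10Eq29TubeLine` (`Tube`, `TubeCfg`, `expLine`), never asserted to be Bałaban's;
NO new cited facts, NO new quotation, NO summit vocabulary.
-/
import Mathlib
import Literature.MathematicalPhysics.QuantumFieldTheory.Balaban1983to89.B10Eq61Leaves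

/-!
# `Balaban1983to89.B10Eq29CplxLine` — [Balaban1985UV3] (29) p. 263 THROUGH A COMPLEX BACKGROUND: the line
# `ζ ↦ exp ζ(S + P)·U₀` — `S` skew-adjoint of ANY size (the real potential `iη𝓗`), `P` a SMALL arbitrary part (the
# complex part of the background, [I] (1.13) `|A′| < α₁`; [II] p. 21: the pieces are extended "to analytic functions
# of 𝐔, 𝐉") — STAYS IN THE TUBE `exp(B)·U` ([5] (3.37), [I] (1.13)) on the strip of half-width
# `(min(1/8, α/2) − p)/(2p + κ)`: HONEST SCOPE (ii) of `…B10Eq29TubeLine` discharged in the C⋆-algebra model, the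
# `p = α₁` slot of `B10Eq61PerSite.inv_halfWidth_le` made LOAD-BEARING, and the second-order theorems of
# `B10Eq61PerSite` / the join of `B10Eq61Leaves` re-exported for complex backgrounds

T. Bałaban, *Ultraviolet stability of three-dimensional lattice pure gauge field theories*, Commun. Math. Phys. **102**,
255–275 (1985) [Balaban1985UV3] (cell paper B10; PDF `paper:balaban1985-cmp102-uv-stability-3d`, journal page = PDF
page + 254).  The printed analyticity spaces: T. Bałaban, *Propagators for lattice gauge theories in a background
field*, Commun. Math. Phys. **99**, 389–434 (1985) [Balaban1985BackgroundPropagators] = [5] of the paper, (3.37)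
p. 396; T. Bałaban, *Renormalization group approach to lattice gauge field theories. I*, Commun. Math. Phys. **109**,
249–301 (1987) [Balaban1987RG1] = [I], (1.11)–(1.13) p. 262; *… II*, Commun. Math. Phys. **116**, 1–22 (1988)
[Balaban1988RG2Cluster] = [II], pp. 15, 21.  All quotations in §0 are those already read off the renders for
`…B10Eq61PerSite` §0 (v1.1) and `…B10Eq29TubeLine` §0 (v1) (renders `1985-cmp102-uv-stability-3d-p009-x2.png` = p. 263,
`1985-cmp99-background-propagators-p008-x2.png` = p. 396, `1987-cmp109-rg-I-small-field-p014-x2.png` = p. 262,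
`1988-cmp116-rg-II-cluster-p015-x2.png` = p. 15, `1988-cmp116-rg-II-cluster-p021-x2.png` = p. 21, READ AS IMAGES there);
this module adds NO new quotation.  Siblings (imported BY NAME, byte-identical): `…B10Eq61Leaves` (hence
`…B10Eq29TubeLine`, `…B10Eq61PerSite`, b13's `…B13DerivZeroGauge`): `Tube`, `TubeCfg`, `expLine`, `Rect`,
`LineInStrip` (L1′), `AnalyticOnStrip` (L2′), `DerivZeroAlongV` (L3′), `diffAlongV`, `inv_halfWidth_le`,
`logHalfBound_diffAlongV_of_derivZero`, `logHalfBound_secondOrder_of_R21`, `bound118_secondOrder_of_R21`,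
`analyticOnStrip_expLine`, `expChart`, `derivZeroAlongV_expLine_of_mem_closure`.

WHY THIS MODULE (the b10 lineage's open edge after `B10Eq29TubeLine` v1 / `B10Eq61Leaves` v1: cell GAPS C-b10g19-1,
HONEST SCOPE (ii) there; README gen 19 «How to continue (gen 20)» node 1).  `B10Eq29TubeLine` put the line (29)
`ζ ↦ exp(ζK)·U₀` in the tube `Tube 𝔸 α = {exp(B)·U : ‖B‖ < α, U unitary}` on the strip `|Im ζ| < α/‖K‖` by the
COMMUTING factorization `exp(ζK) = exp((Im ζ)·iK)·exp((Re ζ)·K)` — valid for `K` SKEW-ADJOINT, i.e. for a REAL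
background `U_{k+1}` (the setting of [Balaban1985UV3] itself: (28) bounds the real `B(c)`).  Its HONEST SCOPE (ii)
recorded what the d = 4 consumer needs: in [II] the localized pieces are extended *"to analytic functions of 𝐔, 𝐉"*
(p. 21), the background runs through the complex space (i)–(ii) of [I] p. 262 (`𝐔 = U′U`, `U′ = exp iξA′`, `A′ ∈ gᶜ`,
`|A′| < α₁`; [5] (3.37)), so at one bond the generator of the line is `K = S + P` with `S` skew-adjoint of size `κ_X`
(the real part, (28) / [I] (1.12): `O(1)LMBα₀(1 + d(X))`) and `P` a complex part of size `≲ α₁` which does NOT commute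
with `S`; the half-width was predicted there as `h_X ≈ (α′₁ − α₁)/(α₁ + κ_X)` and the missing input named ("a
Duhamel-type estimate").  This module supplies it, in the same model.  THE TWO [folklore] INPUTS: (§1) the
INTERACTION-PICTURE ESTIMATE `‖exp(S + T)·exp(−S) − 1‖ ≤ e^{‖T‖} − 1` for `S` skew-adjoint and `T` ARBITRARY —
UNIFORM IN `‖S‖`, because `W(t) = exp(t(S + T))·exp(−tS)` has `W′ = exp(t(S + T))·T·exp(−tS)` of norm
`≤ ‖W‖·‖T‖` (`exp(±tS)` unitary), closed by Grönwall (Mathlib `norm_le_gronwallBound_of_norm_deriv_right_le`); (§2)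
the POLAR DECOMPOSITION INTO THE TUBE: an invertible `V` with `‖VV⋆ − 1‖ ≤ r < 1` is `exp(B)·U` with `B = ½·log(VV⋆)`
SELF-ADJOINT of norm `≤ −½log(1 − r)` (real continuous functional calculus: `σ(VV⋆) ⊂ [1 − r, 1 + r]`,
`exp ∘ log = id` there, isometry of the calculus) and `U = exp(−B)·V` unitary.  THE POINT (§3, `exp_add_mul_mem_tube`):
`V = exp(S + T)·U₀` has `VV⋆ = WW⋆` (`exp S`, `U₀` unitary), so `‖VV⋆ − 1‖ ≤ e^{2‖T‖} − 1`, and `V ∈ Tube 𝔸 α` as soon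
as `‖T‖ ≤ 1/8` and `2‖T‖ ≤ α` — for `S` of ANY norm.  On the line (§4) `ζ(S + P) = (Re ζ)·S + [(Im ζ)·iS + ζ·P]`:
the REAL DIRECTION IS FREE for the skew part exactly as in `B10Eq29TubeLine` (now modulo the interaction-picture
correction instead of a commuting unitary factor), while the tube's complex half-width must absorb the imaginary
direction of `S` AND both directions of `P`: `|Im ζ|·κ + |ζ|·p ≤ h·κ + (1 + 2h)·p = p + h·(2p + κ)` on `Rect h`
(`|ζ| ≤ |Re ζ| + |Im ζ| < 1 + 2h`), whence the half-width `h = (min(1/8, α/2) − p)/(2p + κ)`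
(`exp_smul_add_mul_mem_tube_of_mem_rect`) — the predicted shape, numerator = what the tube's complex half-width leaves
after the complex part of the background, denominator = the real part plus twice the complex part, with the model's
crude absolute numbers `1/8` and `2` standing in for the unprinted "how much bigger" of [II] p. 15 (*"with constants
α′₀, α′₁ much bigger than α₀, α₁"*): in the model, `α′₁ > 2α₁` (and `α₁ < 1/8`).  §5 turns it into (L1′)/(L2′) for
configurations whose bond generators are each within `p` of a skew-adjoint element of norm `≤ κ_X`; §6 re-exports the
second-order theorems of `B10Eq61PerSite` with this half-width SUPPLIED — `inv_halfWidth_le` is used with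
`a ↦ min(1/8, a/2) − p` and `p ↦ 2p`, so its `p`-slot, an unused margin in `B10Eq29TubeLine` §4, is now LOAD-BEARING —
in generic letters (constant `8·((2p + q)/(min(1/8, a/2) − p))²·B`) and in the letters of [II] under the smallness
relation `α₁ < min(1/8, α′₁/2)` (constant `64A(1 + c₀²)/(min(1/8, α′₁/2) − α₁)²`, via `logHalfBound_secondOrder_of_R21`
read with its letter `a ↦ (min(1/8, α′₁/2) − α₁)/2`), and joins them with the b13 lineage's (L3′)
(`B10Eq61Leaves.derivZeroAlongV_expLine_of_mem_closure`, which never required the generator to be skew-adjoint — the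
symmetry generators span over `ℂ`, so complex generators in the closed span are detected verbatim).  §7: joint
non-vacuity with the complex part switched ON (`𝔸 = ℂ`, `p = 1/16`) and a genuinely NON-COMMUTING instance in `M₂(ℂ)`
(`S = θ(E₁₂ − E₂₁)` for EVERY real `θ`, `T = σₓ/8`, tube half-width `1/4` — uniform in `‖S‖ = |θ|`, which no
one-exponent reading `exp(B)·1`, `‖B‖ ≈ |θ|`, can give).

CITATION HEADER (lean-in-tree rule).  WHAT IS REPRODUCED (verbatim, §0): [Balaban1985UV3] p. 263 ((29); the
analyticity sentence); [Balaban1985BackgroundPropagators] p. 396 ((3.37)); [Balaban1987RG1] p. 262 ((1.11)–(1.13));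
[Balaban1988RG2Cluster] p. 15 (the three analyticity spaces) and p. 21 (the extension to analytic functions of 𝐔, 𝐉 and
the absolute constant) — all already in `B10Eq61PerSite` §0 / `B10Eq29TubeLine` §0; this module adds NO quotation and
NO cited fact.

WHAT IS KERNEL-CERTIFIED (algebra and elementary analysis of `exp` in a C⋆-algebra, one-variable complex
differentiability, real arithmetic — no object of the papers is constructed):
* §1 [folklore] — THE INTERACTION PICTURE: `exp_real_smul_mem_unitary` (`exp(t•K)` unitary for `K` skew-adjoint, `t`
  real; Mathlib `skewAdjoint.smul_mem`, `exp_mem_unitary_of_mem_skewAdjoint`); `norm_exp_add_mul_exp_neg_sub_one_le`: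
  `S` skew-adjoint, `T` arbitrary ⇒ `‖exp(S + T)·exp(−S) − 1‖ ≤ e^{‖T‖} − 1` (Grönwall on `[0, 1]` with `δ = 0`,
  `K = ε = ‖T‖`; `‖exp(t(S + T))·T·exp(−tS)‖ ≤ ‖T‖·‖W(t) − 1‖ + ‖T‖` by `CStarRing.norm_mul_mem_unitary`);
  `norm_mul_star_self_sub_one_le`: `‖W − 1‖ ≤ w ⇒ ‖WW⋆ − 1‖ ≤ (1 + w)² − 1`.
* §2 [folklore] — THE POLAR DECOMPOSITION INTO THE TUBE: `abs_sub_one_le_of_mem_spectrum` (`x ∈ σ_ℝ(a) ⇒ |x − 1| ≤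
  ‖a − 1‖`, `spectrum.sub_singleton_eq` + `spectrum.norm_le_norm_of_mem`); `abs_log_le_of_abs_sub_one_le` (real:
  `|x − 1| ≤ r < 1 ⇒ |log x| ≤ −log(1 − r)`); `exp_log_of_spectrum_pos` (`a` self-adjoint with POSITIVE real spectrum ⇒
  `exp(CFC.log a) = a` — `cfc_comp'` + `CFC.real_exp_eq_normedSpace_exp`, WITHOUT the order-structure classes
  `PartialOrder`/`StarOrderedRing`/`NonnegSpectrumClass` that Mathlib's `CFC.exp_log` asks and an abstract `CStarAlgebra`
  does not carry); `norm_log_le_of_norm_sub_one_le` (`‖a − 1‖ ≤ r < 1 ⇒ ‖CFC.log a‖ ≤ −log(1 − r)`, `norm_cfc_le`);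
  `exp_neg_mul_mem_unitary` (`V` a unit, `B` self-adjoint, `exp(B + B) = VV⋆` ⇒ `exp(−B)·V` unitary and
  `V = exp(B)·(exp(−B)·V)`); `mem_tube_of_norm_mul_star_self_sub_one_le`: `V` a unit, `‖VV⋆ − 1‖ ≤ r < 1`,
  `−log(1 − r)/2 < α` ⇒ `V ∈ Tube 𝔸 α` (the subsingleton algebra handled apart).
* §3 — THE POINT: numerics `exp_two_mul_sub_one_le` (`0 ≤ x ≤ 1/8 ⇒ e^{2x} − 1 ≤ 5x/2`,
  `Real.abs_exp_sub_one_sub_id_le`) and `neg_log_one_sub_le` (`r < 1 ⇒ −log(1 − r) ≤ r/(1 − r)`);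
  `exp_add_mul_mem_tube`: `S` skew-adjoint, `U₀` unitary, `0 < α`, `‖T‖ ≤ 1/8`, `2‖T‖ ≤ α` ⇒ `exp(S + T)·U₀ ∈ Tube 𝔸 α`
  (chain: `r = e^{2‖T‖} − 1 ≤ 5‖T‖/2 ≤ 5/16`, `−½log(1 − r) ≤ r/(2(1 − r)) ≤ 8r/11 ≤ 20‖T‖/11 < α`);
  `exp_add_mem_tube` (`U₀ = 1`).
* §4 — THE LINE THROUGH A COMPLEX BACKGROUND: `smul_add_split` (`ζ•(S + P) = (Re ζ)•S + [((Im ζ)i)•S + ζ•P]`),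
  `norm_split_le` (the bracket has norm `≤ |Im ζ|‖S‖ + ‖ζ‖‖P‖`), `exp_smul_add_mul_mem_tube` (`q := |Im ζ|‖S‖ + ‖ζ‖‖P‖
  ≤ 1/8`, `2q ≤ α`, `0 < α` ⇒ `exp(ζ•(S + P))·U₀ ∈ Tube 𝔸 α`, via `TubeLine.ofReal_smul_mem_skewAdjoint`),
  `split_le_of_mem_rect` (`‖S‖ ≤ κ`, `‖P‖ ≤ p`, `p ≤ m`, `ζ ∈ Rect ((m − p)/(2p + κ))` ⇒ `q ≤ m`; Mathlib
  `Complex.norm_le_abs_re_add_abs_im`), THE STRIP STATEMENT `exp_smul_add_mul_mem_tube_of_mem_rect` (`p < min(1/8, α/2)`,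
  `ζ ∈ Rect ((min(1/8, α/2) − p)/(2p + κ))` ⇒ in `Tube 𝔸 α`).
* §5 — CONFIGURATIONS, (L1′)/(L2′): `expLine_mem_tubeCfg_cplx`; `lineInStrip_expLine_cplx` — on `sp' X` every bond
  generator within `p` of a skew-adjoint element of norm `≤ κ X` (`∃ S ∈ skewAdjoint 𝔸, ‖S‖ ≤ κ X ∧ ‖gen X φ b − S‖ ≤ p`),
  `0 ≤ p < min(1/8, α/2)`, `0 ≤ κ X`, `0 < 2p + κ X`, base bondwise unitary, `TubeCfg ι 𝔸 α ⊆ sp X` ⇒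
  `LineInStrip sp' sp (expLine gen base) (fun X => (min(1/8, α/2) − p)/(2p + κ X))`; `analyticOnStrip_expLine_cplx`
  (= `TubeLine.analyticOnStrip_expLine` on this (L1′)).
* §6 — THE SECOND-ORDER THEOREMS, HALF-WIDTH SUPPLIED: `logHalfBound_expLine_cplx_of_derivZero` (generic letters,
  `κ X = q(1 + d(X))`: constant `8·((2p + q)/(min(1/8, a/2) − p))²·B`, rate `r − 2`; `inv_halfWidth_le` with
  `a ↦ min(1/8, a/2) − p`, `p ↦ 2p`); `logHalfBound_secondOrder_expLine_cplx_of_R21` ([II]'s letters `p = α₁`,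
  `q = c₀·LM·α₀`, per-LM-cube `A(LM)⁴`, printed R21, `α₁ < min(1/8, a/2)`: constant `64A(1 + c₀²)/(min(1/8, a/2) − α₁)²`,
  rate `r − 2`); `bound118_secondOrder_expLine_cplx_of_R21` ((I.1.18)-shape: `× c₁`, rate `r − 3`); and the JOIN with
  b13's (L3′): `logHalfBound_expLine_cplx_of_mem_closure`, `bound118_secondOrder_expLine_cplx_of_mem_closure` (binders:
  the generator split, base `base₀ X` φ-independent and unitary, `TubeCfg ι 𝔸 a ⊆ sp X`, `E X` holomorphic on `sp X` and
  invariant in the chart under ℂ-linear flows `T l t` with velocities `L l`, `gen X φ ∈ closure (span ℂ (⋃ l, range (L l)))`,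
  the undifferenced bound, the volume bound — NO skew-adjointness and NO (L1′)/(L2′)/(L3′) hypothesis left).
* §7 — NON-VACUITY: (a) `derivZeroAlongV_exE` ((L3′) for `E φ = (φ − 1)²` along the exponential line of ANY generator
  with base `1`), `exGenC = (min ‖φ‖ 1)·i + 1/16`, `exGenC_split`, `example_logHalfBound_expLine_cplx` (every binder of
  `logHalfBound_expLine_cplx_of_derivZero` with `p = 1/16 > 0`, `q = 1`, `a = 1`, `B = 16`, `r = 0`; constant
  `8·((2/16 + 1)/(1/8 − 1/16))²·16`), `example_diffAlongV_exGenC` (the differenced family is `≠ 0`); (b) in `M₂(ℂ)` with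
  the operator norm (`TubeLine.cstarAlgebraMatrix 2` threaded by `letI`, nothing registered as an instance): `mJ = E₁₂ −
  E₂₁` skew (`mJ_mem_skewAdjoint`), `mX = σₓ` unitary (`mX_mem_unitary`), `mJ_mul_mX_ne` (they do NOT commute),
  `example_exp_add_mem_tube_m2`: `exp(θ•J + σₓ/8) ∈ Tube M₂(ℂ) (1/4)` for EVERY real `θ`.

HONEST SCOPE.  (i) MODEL, NOT THE PAPER'S OBJECTS — as `…B10Eq29TubeLine` HONEST SCOPE (i): `Tube 𝔸 α` is the set
`{exp(B)·U}` at ONE bond of a unital C⋆-algebra; the printed spaces [5] (3.35)–(3.37) / [I] (i)–(iii) carry the real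
smallness of `U` with gauge freedom, derivative conditions, scale factors and the averaging condition (iii), none
modelled; in particular the model's real direction is free because `U` is ANY unitary, whereas in print it is free up
to the big-space real bound `α′₀`.  (ii) THE NUMBERS ARE THE MODEL'S: `1/8` and the factor `2` in `p < min(1/8, α/2)`
come from three crude absolute estimates (`e^{2x} − 1 ≤ 5x/2` on `[0, 1/8]`, `−log(1 − r) ≤ r/(1 − r)`, `1 − r ≥
11/16`); the sharp model condition would be `−½log(2 − e^{2q}) < α`; NONE of these numbers is Bałaban's, who prints
only *"α′₀, α′₁ much bigger than α₀, α₁"* ([II] p. 15) — what is LOCATED is the SHAPE: numerator `α′₁ − O(α₁)`,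
denominator `κ_X + O(α₁)`, the `p = α₁`-slot of `inv_halfWidth_le` load-bearing.  (iii) `P` ARBITRARY: the printed
complex part is `A′ ∈ gᶜ`, `|A′| < α₁` ([5] (3.37), [I] (1.13)); `iξA′` splits into a skew-adjoint and a self-adjoint
part, and the theorem lets the skew part of `iξA′` sit in `S` (then `κ_X` absorbs `α₁` too) or in `P` — both
bookkeepings are instances of the hypothesis `∃ S ∈ skewAdjoint 𝔸, ‖S‖ ≤ κ X ∧ ‖gen X φ b − S‖ ≤ p`; which one the
inductive spaces use, and whether the per-cube bound `A(LM)⁴` of the (63)-type terms holds on the SAME space that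
contains the tube (WHICH SPACE, `…B10Eq29TubeLine` HONEST SCOPE (iii), cell GAPS C-adv2-65), is not decided here — in
§6 it is the pair of binders `TubeCfg ι 𝔸 a ⊆ sp X` + `B13.LogHalfBound D sp E …` on one `sp`.  (iv) The
interaction-picture estimate is [folklore] functional analysis (Dyson/Duhamel; here via Grönwall), the polar
decomposition is [folklore] C⋆-algebra; neither is in the papers, which import the analyticity of the pieces in the
background field BY REFERENCE (p. 263: *"These properties follow from the results of previous papers"*; [II] p. 15)
— the module is the kernel form of "the line (29) through a complex background of the kind (1.13) stays in the
analyticity tube on a strip whose width the complex half-width `α′₁` sets after subtracting the background's own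
complex part", nothing more.  (v) (L3′) is b13's (joined, not touched); the undifferenced bound, the volume bound,
`A`, `a`, `c₀`, `c₁`, the flows `T l t` and the membership `hmem` for the ACTUAL (61)/(63)-pieces are hypotheses (cell
GAPS C-B13-32 / C-adv2-63 R1 / C-b10g19-2 (iii)); the module is NOT a proof of (24), (61)–(63), (I.1.18) or Theorem 2,
and NOT summit progress.  (vi) Not done here (README gen 19 nodes 2–4): R21-letters / U(2)- / SU(N)-joint instances,
the two-regime re-join, the located `hmem`/`hinv` for the printed pieces.

## §0. The printed sentences (verbatim; all already in `B10Eq61PerSite` §0 / `B10Eq29TubeLine` §0, read off the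
renders there)

[Balaban1985UV3] p. 263: *"By
the gauge invariance (26), we have 𝒫′₁(g₀, X, U₁) = 𝒫′₁(g₀, X, exp i𝓗(B)), (29) and we expand the function with
respect to 𝓗(B)."*; *"The third property is the analyticity with
respect to U₁. These properties follow from the results of previous papers"*.
[Balaban1985BackgroundPropagators] p. 396: *"We assume that they have the form U′U, where U has values in G and
U′ = e^{iηA′}, A′ ∈ gᶜ. For a given pair of positive numbers α₀, α₁ we consider the class of these configurations
satisfying: U satisfies the condition (3.35), and |A′| < α₁(L^jη)^{−1}, |∇^η_U A′| < α₁(L^jη)^{−2} on Ω_j, j = 0, …,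
k; (3.37)"*.
[Balaban1987RG1] p. 262: *"(i) 𝐔 = U′U, U has values in the group G, |∂U − 1| < α₀ξ² on X, (1.11) for each cube
□ ⊂ X of a size O(1)LM there exists a G-valued gauge transformation u defined on □ and such, that Uᵘ = exp iξA, |A|,
|∇^ξA| < O(1)LMBα₀ on □, (1.12) with a sufficiently large constant B (it will be determined later). (ii) U′ =
exp iξA′, A′ has values in the algebra gᶜ, |A′|, |∇^ξ_U A′| < α₁ on X. (1.13)"*.
[Balaban1988RG2Cluster] p. 15: *"The potentials are also analytic functions on the subspace Uᶜ_{k+1}(X, α₀, α₁). The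
quadratic forms and covariances in H(Z) are analytic functions on the space of configurations (𝐔, 𝐉) satisfying the
conditions I.(i)–(iii) on the domain Z, with constants α′₀, α′₁ much bigger than α₀, α₁, therefore we can restrict
them, as analytic functions, to the above subspace."*
[Balaban1988RG2Cluster] p. 21: *"We gather all terms in the expansions, localized in X, and we extend them to analytic
functions of 𝐔, 𝐉. The expression localized in X satisfies the bound (I.1.18) with κ replaced by δ₀M, and with an
absolute constant instead of E₀."*
-/

noncomputable section

open Metric Set NormedSpace
open scoped Topology ComplexConjugate Pointwise

namespace Literature.MathematicalPhysics.QuantumFieldTheory.Balaban1983to89.B10Eq29CplxLine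

open B10Eq61PerSite B10Eq29TubeLine
open B10Eq61Leaves (expChart derivZeroAlongV_expLine_of_mem_closure)

/-! ## §1. The interaction picture: `exp(S + T)·exp(−S)` is within `e^{‖T‖} − 1` of `1`, UNIFORMLY in `‖S‖` -/

section interaction

variable {𝔸 : Type*} [CStarAlgebra 𝔸]

/-- The exponential of a REAL multiple of a skew-adjoint element is unitary (Mathlib `skewAdjoint.smul_mem`,
`NormedSpace.exp_mem_unitary_of_mem_skewAdjoint`). [folklore] -/
theorem exp_real_smul_mem_unitary {K : 𝔸} (hK : K ∈ skewAdjoint 𝔸) (t : ℝ) : exp (t • K) ∈ unitary 𝔸 := by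
  letI : NormedAlgebra ℚ 𝔸 := NormedAlgebra.restrictScalars ℚ ℂ 𝔸
  exact exp_mem_unitary_of_mem_skewAdjoint (skewAdjoint.smul_mem t hK)

/-- **THE INTERACTION-PICTURE ESTIMATE.**  For `S` skew-adjoint and `T` ARBITRARY (not commuting with `S`):
`‖exp(S + T)·exp(−S) − 1‖ ≤ e^{‖T‖} − 1` — independently of `‖S‖`.  Proof: `W(t) := exp(t(S + T))·exp(−tS)` has
`W′(t) = exp(t(S + T))·T·exp(−tS)`, and `‖W′(t)‖ ≤ ‖exp(t(S + T))‖·‖T‖ = ‖W(t)‖·‖T‖ ≤ ‖T‖·‖W(t) − 1‖ + ‖T‖` because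
`exp(±tS)` are UNITARY (`CStarRing.norm_mul_mem_unitary`); Grönwall (Mathlib `norm_le_gronwallBound_of_norm_deriv_right_le`
on `[0, 1]`, `δ = 0`, `K = ε = ‖T‖`) gives `‖W(1) − 1‖ ≤ e^{‖T‖} − 1`.  (The Dyson/Duhamel series would give the same.) [folklore] -/
theorem norm_exp_add_mul_exp_neg_sub_one_le {S : 𝔸} (hS : S ∈ skewAdjoint 𝔸) (T : 𝔸) :
    ‖exp (S + T) * exp (-S) - 1‖ ≤ Real.exp ‖T‖ - 1 := by
  letI : NormedAlgebra ℚ 𝔸 := NormedAlgebra.restrictScalars ℚ ℂ 𝔸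
  rcases subsingleton_or_nontrivial 𝔸 with h𝔸 | h𝔸
  · rw [Subsingleton.elim (exp (S + T) * exp (-S) - 1) 0, norm_zero, sub_nonneg]
    exact Real.one_le_exp (norm_nonneg T)
  have hnS : -S ∈ skewAdjoint 𝔸 := neg_mem hS
  have hderiv : ∀ t : ℝ, HasDerivAt (fun u : ℝ => exp (u • (S + T)) * exp (u • (-S)) - 1)
      (exp (t • (S + T)) * T * exp (t • (-S))) t := by
    intro t
    have h1 : HasDerivAt (fun u : ℝ => exp (u • (S + T))) (exp (t • (S + T)) * (S + T)) t :=
      hasDerivAt_exp_smul_const (S + T) t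
    have h2 : HasDerivAt (fun u : ℝ => exp (u • (-S))) ((-S) * exp (t • (-S))) t :=
      hasDerivAt_exp_smul_const' (-S) t
    have h3 := (h1.mul h2).sub_const (1 : 𝔸)
    have heq : exp (t • (S + T)) * (S + T) * exp (t • (-S)) + exp (t • (S + T)) * ((-S) * exp (t • (-S)))
        = exp (t • (S + T)) * T * exp (t • (-S)) := by noncomm_ring
    rw [heq] at h3
    exact h3
  have hunit : ∀ t : ℝ, exp (t • (-S)) ∈ unitary 𝔸 := fun t => exp_real_smul_mem_unitary hnS t
  have hinv : ∀ t : ℝ, exp (t • (-S)) * exp (t • S) = 1 := by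
    intro t
    rw [← exp_add_of_commute (((Commute.refl S).neg_left).smul_left t |>.smul_right t), smul_neg,
      neg_add_cancel, exp_zero]
  have hbound : ∀ t : ℝ, ‖exp (t • (S + T)) * T * exp (t • (-S))‖ ≤
      ‖T‖ * ‖exp (t • (S + T)) * exp (t • (-S)) - 1‖ + ‖T‖ := by
    intro t
    have e1 : ‖exp (t • (S + T)) * T * exp (t • (-S))‖ ≤ ‖exp (t • (S + T))‖ * ‖T‖ := by
      rw [CStarRing.norm_mul_mem_unitary _ (hunit t)]
      exact norm_mul_le _ _
    have e2 : ‖exp (t • (S + T))‖ ≤ ‖exp (t • (S + T)) * exp (t • (-S)) - 1‖ + 1 := by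
      calc ‖exp (t • (S + T))‖ = ‖(exp (t • (S + T)) * exp (t • (-S)) - 1 + 1) * exp (t • S)‖ := by
            rw [sub_add_cancel, mul_assoc, hinv, mul_one]
        _ = ‖exp (t • (S + T)) * exp (t • (-S)) - 1 + 1‖ :=
            CStarRing.norm_mul_mem_unitary _ (exp_real_smul_mem_unitary hS t)
        _ ≤ ‖exp (t • (S + T)) * exp (t • (-S)) - 1‖ + 1 := (norm_add_le _ _).trans (by rw [norm_one])
    calc ‖exp (t • (S + T)) * T * exp (t • (-S))‖ ≤ ‖exp (t • (S + T))‖ * ‖T‖ := e1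
      _ ≤ (‖exp (t • (S + T)) * exp (t • (-S)) - 1‖ + 1) * ‖T‖ :=
          mul_le_mul_of_nonneg_right e2 (norm_nonneg _)
      _ = ‖T‖ * ‖exp (t • (S + T)) * exp (t • (-S)) - 1‖ + ‖T‖ := by ring
  have hcont : ContinuousOn (fun u : ℝ => exp (u • (S + T)) * exp (u • (-S)) - 1) (Icc 0 1) :=
    fun t _ => (hderiv t).continuousAt.continuousWithinAt
  have h0 : ‖(fun u : ℝ => exp (u • (S + T)) * exp (u • (-S)) - 1) 0‖ ≤ 0 := by simp
  have hG := norm_le_gronwallBound_of_norm_deriv_right_le (δ := 0) (K := ‖T‖) (ε := ‖T‖) (a := 0)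
    (b := 1) hcont (fun t _ => (hderiv t).hasDerivWithinAt) h0 (fun t _ => hbound t) 1
    ⟨zero_le_one, le_rfl⟩
  have hf1 : (fun u : ℝ => exp (u • (S + T)) * exp (u • (-S)) - 1) 1 = exp (S + T) * exp (-S) - 1 := by
    simp
  rw [← hf1]
  refine hG.trans ?_
  rw [sub_zero]
  by_cases hT : ‖T‖ = 0
  · rw [hT, gronwallBound_K0]
    simp
  · rw [gronwallBound_of_K_ne_0 hT]
    simp [div_self hT]

/-- `‖W·W⋆ − 1‖ ≤ (1 + ‖W − 1‖)² − 1` (`W·W⋆ − 1 = (W − 1)(W⋆ − 1) + (W − 1) + (W⋆ − 1)`, `‖W⋆ − 1‖ = ‖W − 1‖`).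
[folklore] -/
theorem norm_mul_star_self_sub_one_le {W : 𝔸} {w : ℝ} (hw : ‖W - 1‖ ≤ w) :
    ‖W * star W - 1‖ ≤ (1 + w) ^ 2 - 1 := by
  have hw0 : 0 ≤ w := (norm_nonneg _).trans hw
  have hstar : ‖star W - 1‖ ≤ w := by
    rw [← norm_star, star_sub, star_star, star_one]; exact hw
  have hid : W * star W - 1 = (W - 1) * (star W - 1) + (W - 1) + (star W - 1) := by noncomm_ring
  rw [hid]
  calc ‖(W - 1) * (star W - 1) + (W - 1) + (star W - 1)‖
      ≤ ‖W - 1‖ * ‖star W - 1‖ + ‖W - 1‖ + ‖star W - 1‖ :=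
        (norm_add_le _ _).trans (add_le_add ((norm_add_le _ _).trans
          (add_le_add (norm_mul_le _ _) le_rfl)) le_rfl)
    _ ≤ w * w + w + w := by gcongr
    _ = (1 + w) ^ 2 - 1 := by ring

end interaction

/-! ## §2. The left polar decomposition INTO THE TUBE: `V` invertible with `‖V·V⋆ − 1‖ ≤ r < 1` is `exp(B)·U` with
`B = ½·log(V·V⋆)` self-adjoint, `‖B‖ ≤ −½·log(1 − r)`, `U` unitary (continuous functional calculus) -/

section polar

variable {𝔸 : Type*} [CStarAlgebra 𝔸]

/-- The real spectrum of `a` lies within `‖a − 1‖` of `1` (`σ(a) − 1 = σ(a − 1)` and the spectral radius bound).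
[folklore] -/
theorem abs_sub_one_le_of_mem_spectrum [Nontrivial 𝔸] {a : 𝔸} {x : ℝ} (hx : x ∈ spectrum ℝ a) :
    |x - 1| ≤ ‖a - 1‖ := by
  have h1 : x - 1 ∈ spectrum ℝ a - {(1 : ℝ)} := Set.sub_mem_sub hx (Set.mem_singleton 1)
  rw [spectrum.sub_singleton_eq, map_one] at h1
  have := spectrum.norm_le_norm_of_mem h1
  simpa [Real.norm_eq_abs] using this

/-- Real arithmetic: `|x − 1| ≤ r < 1` ⇒ `|log x| ≤ −log(1 − r)` (`log(1 + r) ≤ −log(1 − r)` as `(1 + r)(1 − r) ≤ 1`).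
[folklore] -/
theorem abs_log_le_of_abs_sub_one_le {x r : ℝ} (hx : |x - 1| ≤ r) (hr : r < 1) :
    |Real.log x| ≤ -Real.log (1 - r) := by
  obtain ⟨h1, h2⟩ := abs_le.mp hx
  have hx1 : 1 - r ≤ x := by linarith
  have hx2 : x ≤ 1 + r := by linarith
  have h1r : 0 < 1 - r := by linarith
  have hxpos : 0 < x := h1r.trans_le hx1
  rcases le_or_gt 1 x with hx' | hx'
  · have hlog0 : 0 ≤ Real.log x := Real.log_nonneg hx'
    rw [abs_of_nonneg hlog0]
    have hA : Real.log x ≤ Real.log (1 + r) := Real.log_le_log hxpos hx2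
    have hB : Real.log (1 + r) + Real.log (1 - r) ≤ 0 := by
      rw [← Real.log_mul (by linarith) h1r.ne']
      apply Real.log_nonpos (by nlinarith) (by nlinarith)
    linarith
  · have hlog0 : Real.log x < 0 := Real.log_neg hxpos hx'
    rw [abs_of_neg hlog0]
    have := Real.log_le_log h1r hx1
    linarith

/-- `exp ∘ log = id` on self-adjoint elements with POSITIVE real spectrum, via the real continuous functional calculus
(`cfc_comp'`, `CFC.real_exp_eq_normedSpace_exp`); stated without the order-structure classes that Mathlib's
`CFC.exp_log` asks of `𝔸`. [folklore] -/
theorem exp_log_of_spectrum_pos {a : 𝔸} (ha : IsSelfAdjoint a) (hpos : ∀ x ∈ spectrum ℝ a, 0 < x) :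
    exp (CFC.log a) = a := by
  have ha₂ : ∀ x ∈ spectrum ℝ a, x ≠ 0 := fun x hx => (hpos x hx).ne'
  rw [← CFC.real_exp_eq_normedSpace_exp .log, CFC.log,
    ← cfc_comp' Real.exp Real.log a (by fun_prop) (by fun_prop (disch := assumption))]
  conv_rhs => rw [← cfc_id (R := ℝ) a]
  refine cfc_congr fun x hx => ?_
  simp [Real.exp_log (hpos x hx)]

/-- `‖a − 1‖ ≤ r < 1` ⇒ `‖log a‖ ≤ −log(1 − r)` (isometric functional calculus, `norm_cfc_le`, and the two lemmas
above). [folklore] -/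
theorem norm_log_le_of_norm_sub_one_le [Nontrivial 𝔸] {a : 𝔸} {r : ℝ} (hr : ‖a - 1‖ ≤ r) (hr1 : r < 1) :
    ‖CFC.log a‖ ≤ -Real.log (1 - r) := by
  have hr0 : 0 ≤ r := (norm_nonneg _).trans hr
  have hc : 0 ≤ -Real.log (1 - r) := by
    rw [neg_nonneg]; exact Real.log_nonpos (by linarith) (by linarith)
  rw [CFC.log]
  refine norm_cfc_le hc fun x hx => ?_
  rw [Real.norm_eq_abs]
  exact abs_log_le_of_abs_sub_one_le ((abs_sub_one_le_of_mem_spectrum hx).trans hr) hr1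

/-- The unitary factor: `V` invertible, `B` self-adjoint with `exp(B + B) = V·V⋆` ⇒ `U := exp(−B)·V` is unitary and
`V = exp(B)·U` (`U⋆U = 1` from `UU⋆ = 1`-type identities by cancelling the unit `V`; `star (exp(−B)) = exp(−B)`).
[folklore] -/
theorem exp_neg_mul_mem_unitary {V B : 𝔸} (hV : IsUnit V) (hB : IsSelfAdjoint B)
    (hexp : exp (B + B) = V * star V) : exp (-B) * V ∈ unitary 𝔸 ∧ V = exp B * (exp (-B) * V) := by
  letI : NormedAlgebra ℚ 𝔸 := NormedAlgebra.restrictScalars ℚ ℂ 𝔸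
  have hc1 : exp B * exp (-B) = 1 := by
    rw [← exp_add_of_commute (Commute.refl B).neg_right, add_neg_cancel, exp_zero]
  have hc2 : exp (-B) * exp B = 1 := by
    rw [← exp_add_of_commute (Commute.refl B).neg_left, neg_add_cancel, exp_zero]
  have hBB : exp (B + B) = exp B * exp B := exp_add_of_commute (Commute.refl B)
  have hstar : star (exp (-B)) = exp (-B) := by
    rw [star_exp, star_neg, hB.star_eq]
  refine ⟨?_, ?_⟩
  · rw [Unitary.mem_iff]
    constructor
    · have key : V * (star V * (exp (-B) * exp (-B)) * V) = V * 1 := by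
        calc V * (star V * (exp (-B) * exp (-B)) * V)
            = (V * star V) * (exp (-B) * exp (-B)) * V := by noncomm_ring
          _ = exp B * exp B * (exp (-B) * exp (-B)) * V := by rw [← hexp, hBB]
          _ = exp B * (exp B * exp (-B)) * exp (-B) * V := by noncomm_ring
          _ = V * 1 := by rw [hc1, mul_one, hc1, one_mul, mul_one]
      have := hV.mul_left_cancel key
      calc star (exp (-B) * V) * (exp (-B) * V) = star V * (exp (-B) * exp (-B)) * V := by
            rw [star_mul, hstar]; noncomm_ring
        _ = 1 := this
    · calc exp (-B) * V * star (exp (-B) * V) = exp (-B) * (V * star V) * exp (-B) := by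
            rw [star_mul, hstar]; noncomm_ring
        _ = exp (-B) * (exp B * exp B) * exp (-B) := by rw [← hexp, hBB]
        _ = (exp (-B) * exp B) * (exp B * exp (-B)) := by noncomm_ring
        _ = 1 := by rw [hc1, hc2, mul_one]
  · rw [← mul_assoc, hc1, one_mul]

/-- **THE POLAR DECOMPOSITION INTO THE TUBE.**  `V` invertible, `‖V·V⋆ − 1‖ ≤ r < 1`, `−log(1 − r)/2 < α` ⇒
`V ∈ Tube 𝔸 α`: `V = exp(B)·U` with `B = ½·log(V·V⋆)` SELF-ADJOINT of norm `≤ −½log(1 − r)` and `U = exp(−B)·V`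
unitary.  (For `𝔸 = M_N(ℂ)`: `V = e^{B}U`, `B` Hermitian, `U ∈ U(N)` — the form `exp(iξA′)·U`, `A′ = −iB/ξ ∈ i·𝔲(N) ⊂
gᶜ`, of [I] (1.13) / [5] (3.37).) [cite: Balaban1987RG1, (1.13) p.262; Balaban1985BackgroundPropagators, (3.37) p.396] -/
theorem mem_tube_of_norm_mul_star_self_sub_one_le {V : 𝔸} (hV : IsUnit V) {r α : ℝ}
    (hr : ‖V * star V - 1‖ ≤ r) (hr1 : r < 1) (hα : -Real.log (1 - r) / 2 < α) : V ∈ Tube 𝔸 α := by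
  letI : NormedAlgebra ℚ 𝔸 := NormedAlgebra.restrictScalars ℚ ℂ 𝔸
  have hr0 : 0 ≤ r := (norm_nonneg _).trans hr
  have hlog0 : 0 ≤ -Real.log (1 - r) := by
    rw [neg_nonneg]; exact Real.log_nonpos (by linarith) (by linarith)
  have hα0 : 0 < α := lt_of_le_of_lt (by positivity) hα
  rcases subsingleton_or_nontrivial 𝔸 with h𝔸 | h𝔸
  · refine ⟨0, V, by rw [norm_zero]; exact hα0, ?_, by rw [exp_zero, one_mul]⟩
    rw [Unitary.mem_iff]; constructor <;> exact Subsingleton.elim _ _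
  have ha : IsSelfAdjoint (V * star V) := IsSelfAdjoint.mul_star_self V
  have hspec : ∀ x ∈ spectrum ℝ (V * star V), |x - 1| ≤ r := fun x hx =>
    (abs_sub_one_le_of_mem_spectrum hx).trans hr
  have hpos : ∀ x ∈ spectrum ℝ (V * star V), 0 < x := fun x hx => by
    have := (abs_le.mp (hspec x hx)).1; linarith
  have hLsa : IsSelfAdjoint (CFC.log (V * star V)) := by
    rw [CFC.log]; exact cfc_predicate _ _
  have hexpL : exp (CFC.log (V * star V)) = V * star V := exp_log_of_spectrum_pos ha hpos
  have hLnorm : ‖CFC.log (V * star V)‖ ≤ -Real.log (1 - r) := norm_log_le_of_norm_sub_one_le hr hr1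
  set B : 𝔸 := (1 / 2 : ℝ) • CFC.log (V * star V) with hB_def
  have hBsa : IsSelfAdjoint B := (IsSelfAdjoint.all (1 / 2 : ℝ)).smul hLsa
  have hBB : B + B = CFC.log (V * star V) := by
    rw [hB_def, ← add_smul]; norm_num
  have hexp : exp (B + B) = V * star V := by rw [hBB, hexpL]
  obtain ⟨hU, hVU⟩ := exp_neg_mul_mem_unitary hV hBsa hexp
  refine ⟨B, exp (-B) * V, ?_, hU, hVU⟩
  calc ‖B‖ = (1 / 2 : ℝ) * ‖CFC.log (V * star V)‖ := by
        rw [hB_def, norm_smul, Real.norm_of_nonneg (by norm_num)]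
    _ ≤ (1 / 2) * (-Real.log (1 - r)) := by gcongr
    _ = -Real.log (1 - r) / 2 := by ring
    _ < α := hα

end polar

/-! ## §3. THE POINT — `exp(S + T)·U₀ ∈ Tube 𝔸 α` for `S` skew-adjoint of ANY size, `T` small and arbitrary -/

section point

variable {𝔸 : Type*} [CStarAlgebra 𝔸]

/-- Numerics: `0 ≤ x ≤ 1/8` ⇒ `e^{2x} − 1 ≤ 5x/2` (Mathlib `Real.abs_exp_sub_one_sub_id_le`: `|e^y − 1 − y| ≤ y²`
for `|y| ≤ 1`). [folklore] -/
theorem exp_two_mul_sub_one_le {x : ℝ} (hx0 : 0 ≤ x) (hx : x ≤ 1 / 8) : Real.exp (2 * x) - 1 ≤ 5 / 2 * x := by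
  have h := Real.abs_exp_sub_one_sub_id_le (x := 2 * x) (by rw [abs_of_nonneg (by linarith)]; linarith)
  have h' := (abs_le.mp h).2
  nlinarith

/-- Numerics: `r < 1` ⇒ `−log(1 − r) ≤ r/(1 − r)` (`log y ≤ y − 1` at `y = (1 − r)⁻¹`). [folklore] -/
theorem neg_log_one_sub_le {r : ℝ} (hr : r < 1) : -Real.log (1 - r) ≤ r / (1 - r) := by
  have h1r : 0 < 1 - r := by linarith
  have h := Real.log_le_sub_one_of_pos (inv_pos.mpr h1r)
  rw [Real.log_inv] at h
  have key : (1 - r)⁻¹ - 1 = r / (1 - r) := by field_simp; ring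
  linarith [key]

/-- **THE POINT.**  `S` skew-adjoint (any norm), `U₀` unitary, `T` ARBITRARY with `‖T‖ ≤ 1/8` and `2‖T‖ ≤ α`
(`0 < α`) ⇒ `exp(S + T)·U₀ ∈ Tube 𝔸 α`.  Proof: `V := exp(S + T)U₀` has `VV⋆ = WW⋆` with `W = exp(S + T)exp(−S)` (§1:
`exp(S)`, `U₀` unitary), so `‖VV⋆ − 1‖ ≤ e^{2‖T‖} − 1 =: r ≤ 5‖T‖/2 ≤ 5/16`, and `−½log(1 − r) ≤ r/(2(1 − r)) ≤
20‖T‖/11 < α`; then §2.  For the print: `S = iξ·(real potential)` of ANY size (the real direction is free), `T` = the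
COMPLEX part, which the tube's complex half-width must absorb ([I] (1.13) `|A′| < α₁`; [II] p. 21 *"analytic functions
of 𝐔, 𝐉"*).  The absolute numbers `1/8`, `2` are the model's crude estimates, not the paper's.
[cite: Balaban1987RG1, (1.12)–(1.13) p.262; Balaban1988RG2Cluster, p.21] -/
theorem exp_add_mul_mem_tube {S T U₀ : 𝔸} (hS : S ∈ skewAdjoint 𝔸) (hU₀ : U₀ ∈ unitary 𝔸) {α : ℝ}
    (hα : 0 < α) (hT8 : ‖T‖ ≤ 1 / 8) (hTα : 2 * ‖T‖ ≤ α) : exp (S + T) * U₀ ∈ Tube 𝔸 α := by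
  letI : NormedAlgebra ℚ 𝔸 := NormedAlgebra.restrictScalars ℚ ℂ 𝔸
  have hw : ‖exp (S + T) * exp (-S) - 1‖ ≤ Real.exp ‖T‖ - 1 := norm_exp_add_mul_exp_neg_sub_one_le hS T
  have hES : exp (-S) * exp S = 1 := by
    rw [← exp_add_of_commute (Commute.refl S).neg_left, neg_add_cancel, exp_zero]
  have hWS : exp (S + T) = exp (S + T) * exp (-S) * exp S := by rw [mul_assoc, hES, mul_one]
  have hexpS : exp S ∈ unitary 𝔸 := exp_mem_unitary_of_mem_skewAdjoint hS
  have hVV : exp (S + T) * U₀ * star (exp (S + T) * U₀)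
      = (exp (S + T) * exp (-S)) * star (exp (S + T) * exp (-S)) := by
    conv_lhs => rw [hWS]
    rw [star_mul, star_mul]
    calc exp (S + T) * exp (-S) * exp S * U₀ * (star U₀ * (star (exp S) * star (exp (S + T) * exp (-S))))
        = exp (S + T) * exp (-S) * (exp S * (U₀ * star U₀) * star (exp S))
            * star (exp (S + T) * exp (-S)) := by noncomm_ring
      _ = exp (S + T) * exp (-S) * star (exp (S + T) * exp (-S)) := by
          rw [Unitary.mul_star_self_of_mem hU₀, mul_one, Unitary.mul_star_self_of_mem hexpS, mul_one]
  have hx0 : 0 ≤ ‖T‖ := norm_nonneg _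
  have hr : ‖exp (S + T) * U₀ * star (exp (S + T) * U₀) - 1‖ ≤ Real.exp (2 * ‖T‖) - 1 := by
    rw [hVV]
    have : (1 + (Real.exp ‖T‖ - 1)) ^ 2 - 1 = Real.exp (2 * ‖T‖) - 1 := by
      rw [add_sub_cancel, two_mul, Real.exp_add, sq]
    rw [← this]
    exact norm_mul_star_self_sub_one_le hw
  have hr58 : Real.exp (2 * ‖T‖) - 1 ≤ 5 / 2 * ‖T‖ := exp_two_mul_sub_one_le hx0 hT8
  have hr1 : Real.exp (2 * ‖T‖) - 1 < 1 := by linarith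
  have hrr0 : 0 ≤ Real.exp (2 * ‖T‖) - 1 := by
    rw [sub_nonneg]; exact Real.one_le_exp (by linarith)
  have hlog : -Real.log (1 - (Real.exp (2 * ‖T‖) - 1)) / 2 < α := by
    have h1 := neg_log_one_sub_le hr1
    have h2 : (Real.exp (2 * ‖T‖) - 1) / (1 - (Real.exp (2 * ‖T‖) - 1))
        ≤ 16 / 11 * (Real.exp (2 * ‖T‖) - 1) := by
      rw [div_le_iff₀ (by linarith)]
      nlinarith [mul_nonneg hrr0 (show 0 ≤ 5 / 16 - (Real.exp (2 * ‖T‖) - 1) by linarith)]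
    linarith
  have hU₀u : IsUnit U₀ :=
    isUnit_iff_exists.mpr ⟨star U₀, Unitary.mul_star_self_of_mem hU₀, Unitary.star_mul_self_of_mem hU₀⟩
  have hVu : IsUnit (exp (S + T) * U₀) := (isUnit_exp (S + T)).mul hU₀u
  exact mem_tube_of_norm_mul_star_self_sub_one_le hVu hr hr1 hlog

/-- `U₀ = 1`: `exp(S + T) ∈ Tube 𝔸 α`. [cite: Balaban1987RG1, (1.12)–(1.13) p.262] -/
theorem exp_add_mem_tube {S T : 𝔸} (hS : S ∈ skewAdjoint 𝔸) {α : ℝ} (hα : 0 < α) (hT8 : ‖T‖ ≤ 1 / 8)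
    (hTα : 2 * ‖T‖ ≤ α) : exp (S + T) ∈ Tube 𝔸 α := by
  simpa using exp_add_mul_mem_tube hS (Submonoid.one_mem _) hα hT8 hTα

end point

/-! ## §4. The line (29) through a COMPLEX background: `ζ ↦ exp(ζ(S + P))·U₀` on the strip
`Rect ((min(1/8, α/2) − p)/(2p + κ))` -/

section line

variable {𝔸 : Type*} [CStarAlgebra 𝔸]

/-- The split of the exponent: `ζ•(S + P) = (Re ζ)•S + [((Im ζ)·i)•S + ζ•P]` — a skew-adjoint part of arbitrary size plus
the part the tube must absorb. [folklore] -/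
theorem smul_add_split (S P : 𝔸) (ζ : ℂ) :
    ζ • (S + P) = (ζ.re : ℂ) • S + ((((ζ.im : ℂ) * Complex.I) • S) + ζ • P) := by
  rw [← add_assoc, ← add_smul, Complex.re_add_im, smul_add]

/-- Its size: `‖((Im ζ)i)•S + ζ•P‖ ≤ |Im ζ|·‖S‖ + ‖ζ‖·‖P‖`. [folklore] -/
theorem norm_split_le (S P : 𝔸) (ζ : ℂ) :
    ‖(((ζ.im : ℂ) * Complex.I) • S) + ζ • P‖ ≤ |ζ.im| * ‖S‖ + ‖ζ‖ * ‖P‖ := by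
  refine (norm_add_le _ _).trans (add_le_add (le_of_eq ?_) (le_of_eq (norm_smul _ _)))
  rw [norm_smul, norm_mul, Complex.norm_I, mul_one, Complex.norm_real, Real.norm_eq_abs]

/-- **The line through a complex background stays in the tube as far as `|Im ζ|·‖S‖ + ‖ζ‖·‖P‖` allows**: `S`
skew-adjoint, `U₀` unitary, `P` arbitrary, `q := |Im ζ|‖S‖ + ‖ζ‖‖P‖ ≤ 1/8`, `2q ≤ α`, `0 < α` ⇒
`exp(ζ•(S + P))·U₀ ∈ Tube 𝔸 α` — the REAL direction is free for `S` only; both directions of ζ count for `P`.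
(`TubeLine.exp_smul_mul_mem_tube` is the case `P = 0` with the sharp constant.) [cite: Balaban1985UV3, (29) p.263; Balaban1987RG1, (1.12)–(1.13) p.262; Balaban1988RG2Cluster, p.21] -/
theorem exp_smul_add_mul_mem_tube {S P U₀ : 𝔸} (hS : S ∈ skewAdjoint 𝔸) (hU₀ : U₀ ∈ unitary 𝔸) {ζ : ℂ}
    {α : ℝ} (hα : 0 < α) (hq8 : |ζ.im| * ‖S‖ + ‖ζ‖ * ‖P‖ ≤ 1 / 8)
    (hqα : 2 * (|ζ.im| * ‖S‖ + ‖ζ‖ * ‖P‖) ≤ α) : exp (ζ • (S + P)) * U₀ ∈ Tube 𝔸 α := by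
  rw [smul_add_split]
  have hT := norm_split_le S P ζ
  exact exp_add_mul_mem_tube (ofReal_smul_mem_skewAdjoint hS ζ.re) hU₀ hα (hT.trans hq8) (by linarith)

/-- ON THE STRIP: `‖S‖ ≤ κ`, `‖P‖ ≤ p` (`κ, p ≥ 0`, `2p + κ > 0`), `p ≤ m` and `ζ ∈ Rect ((m − p)/(2p + κ))` ⇒
`|Im ζ|‖S‖ + ‖ζ‖‖P‖ ≤ m` (`|Im ζ| < h`, `‖ζ‖ ≤ |Re ζ| + |Im ζ| < 1 + 2h`, and `h·κ + (1 + 2h)·p = p + h(2p + κ) = m`).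
[folklore] -/
theorem split_le_of_mem_rect {S P : 𝔸} {κ p m : ℝ} (hκ : 0 ≤ κ) (hp : 0 ≤ p) (hden : 0 < 2 * p + κ)
    (hSκ : ‖S‖ ≤ κ) (hPp : ‖P‖ ≤ p) (hpm : p ≤ m) {ζ : ℂ} (hζ : ζ ∈ Rect ((m - p) / (2 * p + κ))) :
    |ζ.im| * ‖S‖ + ‖ζ‖ * ‖P‖ ≤ m := by
  rw [mem_rect] at hζ
  obtain ⟨h1, h2, h3, h4⟩ := hζ
  have hh0 : 0 ≤ (m - p) / (2 * p + κ) := div_nonneg (by linarith) hden.le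
  have him : |ζ.im| ≤ (m - p) / (2 * p + κ) := (abs_lt.mpr ⟨h1, h2⟩).le
  have hre : |ζ.re| ≤ 1 + (m - p) / (2 * p + κ) := (abs_lt.mpr ⟨by linarith, h4⟩).le
  have hnorm : ‖ζ‖ ≤ 1 + 2 * ((m - p) / (2 * p + κ)) := by
    have := Complex.norm_le_abs_re_add_abs_im ζ; linarith
  have hkey : (m - p) / (2 * p + κ) * (2 * p + κ) = m - p := div_mul_cancel₀ _ hden.ne'
  calc |ζ.im| * ‖S‖ + ‖ζ‖ * ‖P‖ ≤ |ζ.im| * κ + ‖ζ‖ * p := by gcongr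
    _ ≤ (m - p) / (2 * p + κ) * κ + (1 + 2 * ((m - p) / (2 * p + κ))) * p :=
        add_le_add (mul_le_mul_of_nonneg_right him hκ) (mul_le_mul_of_nonneg_right hnorm hp)
    _ = p + (m - p) / (2 * p + κ) * (2 * p + κ) := by ring
    _ = m := by rw [hkey]; ring

/-- **THE STRIP STATEMENT.**  `S` skew-adjoint with `‖S‖ ≤ κ` (`κ ≥ 0`), `P` with `‖P‖ ≤ p` (`p ≥ 0`, `2p + κ > 0`),
`p < min(1/8, α/2)`, `U₀` unitary ⇒ `exp(ζ•(S + P))·U₀ ∈ Tube 𝔸 α` for every `ζ ∈ Rect ((min(1/8, α/2) − p)/(2p + κ))`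
— the half-width `h_X ≈ (α′₁ − α₁)/(α₁ + κ_X)` of `…B10Eq29TubeLine` HONEST SCOPE (ii), kernel form (with the model's
absolute numbers): numerator = what the tube's complex half-width leaves after the complex part `p` of the background,
denominator = twice the complex part plus the size `κ` of the real part. [cite: Balaban1985UV3, (28)–(29) p.263; Balaban1987RG1, (1.12)–(1.13) p.262; Balaban1988RG2Cluster, pp.15, 21] -/
theorem exp_smul_add_mul_mem_tube_of_mem_rect {S P U₀ : 𝔸} (hS : S ∈ skewAdjoint 𝔸) (hU₀ : U₀ ∈ unitary 𝔸)
    {κ p α : ℝ} (hκ : 0 ≤ κ) (hp : 0 ≤ p) (hden : 0 < 2 * p + κ) (hSκ : ‖S‖ ≤ κ) (hPp : ‖P‖ ≤ p)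
    (hpm : p < min (1 / 8) (α / 2)) {ζ : ℂ} (hζ : ζ ∈ Rect ((min (1 / 8) (α / 2) - p) / (2 * p + κ))) :
    exp (ζ • (S + P)) * U₀ ∈ Tube 𝔸 α := by
  have hq := split_le_of_mem_rect hκ hp hden hSκ hPp hpm.le hζ
  have h8 := min_le_left (1 / 8 : ℝ) (α / 2)
  have h2 := min_le_right (1 / 8 : ℝ) (α / 2)
  exact exp_smul_add_mul_mem_tube hS hU₀ (by linarith) (hq.trans h8) (by linarith)

end line

/-! ## §5. Configurations: (L1′) and (L2′) for exponential lines through COMPLEX backgrounds -/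

section leaves

variable {D : LocDomainSys} {ι : Type*} {𝔸 : Type*} [CStarAlgebra 𝔸]

/-- The line `expLine gen base X φ` lies in the bondwise tube `TubeCfg ι 𝔸 α` on the strip
`Rect ((min(1/8, α/2) − p)/(2p + κ))` when every bond generator is within `p` of a skew-adjoint element of norm `≤ κ`
and the base point is bondwise unitary. [cite: Balaban1985UV3, (28)–(29) p.263; Balaban1987RG1, (1.12)–(1.13) p.262] -/
theorem expLine_mem_tubeCfg_cplx {gen base : D.Dom → (ι → 𝔸) → ι → 𝔸} {X : D.Dom} {φ : ι → 𝔸} {κ p α : ℝ}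
    (hκ : 0 ≤ κ) (hp : 0 ≤ p) (hden : 0 < 2 * p + κ) (hpm : p < min (1 / 8) (α / 2))
    (hsplit : ∀ b, ∃ S ∈ skewAdjoint 𝔸, ‖S‖ ≤ κ ∧ ‖gen X φ b - S‖ ≤ p) (hbase : ∀ b, base X φ b ∈ unitary 𝔸)
    {ζ : ℂ} (hζ : ζ ∈ Rect ((min (1 / 8) (α / 2) - p) / (2 * p + κ))) :
    expLine gen base X φ ζ ∈ TubeCfg ι 𝔸 α := by
  intro b
  obtain ⟨S, hS, hSκ, hP⟩ := hsplit b
  have heq : expLine gen base X φ ζ b = exp (ζ • (S + (gen X φ b - S))) * base X φ b := by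
    rw [add_sub_cancel]; rfl
  rw [heq]
  exact exp_smul_add_mul_mem_tube_of_mem_rect hS (hbase b) hκ hp hden hSκ hP hpm hζ

/-- **(L1′) DISCHARGED for exponential lines through complex backgrounds**: on `sp' X` let every bond generator
`gen X φ b` be within `p` of a SKEW-ADJOINT element of norm `≤ κ X` (real part of the background of size `κ_X`, (28) /
[I] (1.12); complex part of size `p`, [I] (1.13) `|A′| < α₁`), `0 ≤ p < min(1/8, α/2)`, the base point bondwise unitary,
and `TubeCfg ι 𝔸 α ⊆ sp X` (the analyticity space CONTAINS the tube of complex half-width `α` — for [II] p. 15 the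
covariances' `α′₁`): then `LineInStrip sp' sp (expLine gen base) (fun X => (min(1/8, α/2) − p)/(2p + κ X))`.  The
requirement `p < α/2` is the model's form of p. 15's *"α′₀, α′₁ much bigger than α₀, α₁"*. [cite: Balaban1985UV3, (28)–(29) p.263; Balaban1987RG1, (1.12)–(1.13) p.262; Balaban1988RG2Cluster, p.15] -/
theorem lineInStrip_expLine_cplx {sp' sp : D.Dom → Set (ι → 𝔸)} {gen base : D.Dom → (ι → 𝔸) → ι → 𝔸}
    {κ : D.Dom → ℝ} {p α : ℝ} (hp : 0 ≤ p) (hpm : p < min (1 / 8) (α / 2)) (hκ : ∀ X, 0 ≤ κ X)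
    (hden : ∀ X, 0 < 2 * p + κ X)
    (hsplit : ∀ X φ, φ ∈ sp' X → ∀ b, ∃ S ∈ skewAdjoint 𝔸, ‖S‖ ≤ κ X ∧ ‖gen X φ b - S‖ ≤ p)
    (hbase : ∀ X φ, φ ∈ sp' X → ∀ b, base X φ b ∈ unitary 𝔸) (hsp : ∀ X, TubeCfg ι 𝔸 α ⊆ sp X) :
    LineInStrip sp' sp (expLine gen base) (fun X => (min (1 / 8) (α / 2) - p) / (2 * p + κ X)) :=
  fun X φ hφ _ hζ =>
    hsp X (expLine_mem_tubeCfg_cplx (hκ X) hp (hden X) hpm (hsplit X φ hφ) (hbase X φ hφ) hζ)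

variable [Fintype ι]

/-- **(L2′)** along these lines is `…B10Eq29TubeLine.analyticOnStrip_expLine` verbatim (terms holomorphic on `sp X` +
(L1′)); recorded with the present half-width for reference. [cite: Balaban1985UV3, p.263 (before (27)); Balaban1988RG2Cluster, p.15] -/
theorem analyticOnStrip_expLine_cplx {sp' sp : D.Dom → Set (ι → 𝔸)} {E : D.Dom → (ι → 𝔸) → ℂ}
    {gen base : D.Dom → (ι → 𝔸) → ι → 𝔸} {κ : D.Dom → ℝ} {p α : ℝ} (hp : 0 ≤ p)
    (hpm : p < min (1 / 8) (α / 2)) (hκ : ∀ X, 0 ≤ κ X) (hden : ∀ X, 0 < 2 * p + κ X)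
    (hsplit : ∀ X φ, φ ∈ sp' X → ∀ b, ∃ S ∈ skewAdjoint 𝔸, ‖S‖ ≤ κ X ∧ ‖gen X φ b - S‖ ≤ p)
    (hbase : ∀ X φ, φ ∈ sp' X → ∀ b, base X φ b ∈ unitary 𝔸) (hsp : ∀ X, TubeCfg ι 𝔸 α ⊆ sp X)
    (hE : ∀ X, DifferentiableOn ℂ (E X) (sp X)) :
    AnalyticOnStrip sp' E (expLine gen base) (fun X => (min (1 / 8) (α / 2) - p) / (2 * p + κ X)) :=
  analyticOnStrip_expLine hE (lineInStrip_expLine_cplx hp hpm hκ hden hsplit hbase hsp)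

end leaves

/-! ## §6. The second-order theorems of `B10Eq61PerSite` along complex-background lines, half-width SUPPLIED; and the
join with the b13 lineage's (L3′) (`B10Eq61Leaves.derivZeroAlongV_expLine_of_mem_closure`, which never needed the
generator to be skew-adjoint) -/

section secondOrder

variable {D : LocDomainSys} {ι : Type*} [Fintype ι] {𝔸 : Type*} [CStarAlgebra 𝔸]
  {sp' sp : D.Dom → Set (ι → 𝔸)} {E : D.Dom → (ι → 𝔸) → ℂ} {gen base : D.Dom → (ι → 𝔸) → ι → 𝔸}
  {nX : D.Dom → ℕ}

/-- **THE SUBTRACTION (61) AT SECOND ORDER ALONG COMPLEX-BACKGROUND LINES, generic letters.**  On `sp' X` every bond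
generator is within `p` of a skew-adjoint element of norm `≤ q·(1 + d(X))` (`p, q ≥ 0`, `p + q > 0`), the tube
half-width `a` has `p < min(1/8, a/2)`, base unitary, `TubeCfg ι 𝔸 a ⊆ sp X`, terms holomorphic on `sp X` with the
undifferenced per-cube bound `B` at rate `r`, and (L3′): then the differenced family obeys the per-cube shape with
constant `8·((2p + q)/(min(1/8, a/2) − p))²·B` at rate `r − 2` — `B10Eq61PerSite.logHalfBound_diffAlongV_of_derivZero`
with `h X = (min(1/8, a/2) − p)/(2p + q(1 + d(X)))` SUPPLIED (§5) and `inv_halfWidth_le` read with ITS `p`-SLOT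
LOAD-BEARING (`a ↦ min(1/8, a/2) − p`, `p ↦ 2p`). [cite: Balaban1985UV3, p.272 (after (63)); (28)–(29) p.263; (32) p.264; Balaban1987RG1, (1.12)–(1.13) p.262] -/
theorem logHalfBound_expLine_cplx_of_derivZero {B r a p q : ℝ} (hp : 0 ≤ p) (hq : 0 ≤ q) (hpq : 0 < p + q)
    (hpa : p < min (1 / 8) (a / 2)) (hB : 0 ≤ B)
    (hsplit : ∀ X φ, φ ∈ sp' X → ∀ b, ∃ S ∈ skewAdjoint 𝔸,
      ‖S‖ ≤ q * (1 + D.dj X) ∧ ‖gen X φ b - S‖ ≤ p)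
    (hbase : ∀ X φ, φ ∈ sp' X → ∀ b, base X φ b ∈ unitary 𝔸) (hsp : ∀ X, TubeCfg ι 𝔸 a ⊆ sp X)
    (hE : ∀ X, DifferentiableOn ℂ (E X) (sp X)) (h0 : DerivZeroAlongV sp' E (expLine gen base))
    (hEb : B13.LogHalfBound D sp E nX B r) :
    B13.LogHalfBound D sp' (diffAlongV E (expLine gen base)) nX
      (8 * ((2 * p + q) / (min (1 / 8) (a / 2) - p)) ^ 2 * B) (r - 2) := by
  have hm : 0 < min (1 / 8) (a / 2) - p := by linarith
  have hqd : ∀ X, 0 ≤ q * (1 + D.dj X) := fun X => mul_nonneg hq (by linarith [D.dj_nonneg X])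
  have hden : ∀ X, 0 < 2 * p + q * (1 + D.dj X) := fun X => by
    have hd := D.dj_nonneg X
    nlinarith [mul_nonneg hq hd]
  have hh : ∀ X, 0 < (min (1 / 8) (a / 2) - p) / (2 * p + q * (1 + D.dj X)) := fun X => div_pos hm (hden X)
  have hH : ∀ X, ((min (1 / 8) (a / 2) - p) / (2 * p + q * (1 + D.dj X)))⁻¹ ≤
      (2 * p + q) / (min (1 / 8) (a / 2) - p) * (1 + D.dj X) := fun X =>
    inv_halfWidth_le hm (by linarith) (D.dj_nonneg X)
  have hdom : LineInStrip sp' sp (expLine gen base)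
      (fun X => (min (1 / 8) (a / 2) - p) / (2 * p + q * (1 + D.dj X))) :=
    lineInStrip_expLine_cplx (κ := fun X => q * (1 + D.dj X)) hp hpa hqd hden hsplit hbase hsp
  have han : AnalyticOnStrip sp' E (expLine gen base)
      (fun X => (min (1 / 8) (a / 2) - p) / (2 * p + q * (1 + D.dj X))) :=
    analyticOnStrip_expLine hE hdom
  exact logHalfBound_diffAlongV_of_derivZero hh hH hB hdom han h0 hEb

/-- **THE SAME IN THE LETTERS OF [II]** (`p = α₁` the complex part of the background, `q = c₀·LM·α₀` its real part per
unit of `1 + d`, undifferenced per-LM-cube constant `A(LM)⁴`, tube half-width `a` = the covariances' `α′₁`, printed R21)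
under the NEW smallness relation `α₁ < min(1/8, a/2)`: the differenced pieces obey the per-cube shape with the L,
M-INDEPENDENT constant `64A(1 + c₀²)/(min(1/8, a/2) − α₁)²` at rate `r − 2` — `B10Eq61PerSite.logHalfBound_secondOrder_of_R21`
applied with ITS half-width letter `a ↦ (min(1/8, a/2) − α₁)/2` (the factor 2: `2α₁ + q ≤ 2(α₁ + q)`).  Remaining
binders: the generator split, base unitary, `TubeCfg ι 𝔸 a ⊆ sp X` + holomorphy ON THE SAME `sp` (WHICH space:
`…B10Eq29TubeLine` HONEST SCOPE (iii)), (L3′), the undifferenced bound. [cite: Balaban1988RG2Cluster, pp.15, 20–21; Balaban1985UV3, (29) p.263, (32) p.264, p.272; Balaban1987RG1, (1.12)–(1.13) p.262] -/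
theorem logHalfBound_secondOrder_expLine_cplx_of_R21 (c : B13.Consts) (h21 : c.R21)
    (hLM : 1 ≤ (c.L : ℝ) * c.M) (hα₀ : 0 ≤ c.α₀) (hα₁ : 0 < c.α₁) {A a c₀ r : ℝ} (hA : 0 ≤ A) (hc₀ : 0 ≤ c₀)
    (hα₁a : c.α₁ < min (1 / 8) (a / 2))
    (hsplit : ∀ X φ, φ ∈ sp' X → ∀ b, ∃ S ∈ skewAdjoint 𝔸,
      ‖S‖ ≤ c₀ * ((c.L : ℝ) * c.M) * c.α₀ * (1 + D.dj X) ∧ ‖gen X φ b - S‖ ≤ c.α₁)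
    (hbase : ∀ X φ, φ ∈ sp' X → ∀ b, base X φ b ∈ unitary 𝔸) (hsp : ∀ X, TubeCfg ι 𝔸 a ⊆ sp X)
    (hE : ∀ X, DifferentiableOn ℂ (E X) (sp X)) (h0 : DerivZeroAlongV sp' E (expLine gen base))
    (hEb : B13.LogHalfBound D sp E nX (A * ((c.L : ℝ) * c.M) ^ 4) r) :
    B13.LogHalfBound D sp' (diffAlongV E (expLine gen base)) nX
      (64 * A * (1 + c₀ ^ 2) / (min (1 / 8) (a / 2) - c.α₁) ^ 2) (r - 2) := by
  have hLM0 : 0 ≤ (c.L : ℝ) * c.M := zero_le_one.trans hLM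
  have hq : 0 ≤ c₀ * ((c.L : ℝ) * c.M) * c.α₀ := mul_nonneg (mul_nonneg hc₀ hLM0) hα₀
  have hm : 0 < min (1 / 8) (a / 2) - c.α₁ := by linarith
  have hqd : ∀ X, 0 ≤ c₀ * ((c.L : ℝ) * c.M) * c.α₀ * (1 + D.dj X) := fun X =>
    mul_nonneg hq (by linarith [D.dj_nonneg X])
  have hden : ∀ X, 0 < 2 * c.α₁ + c₀ * ((c.L : ℝ) * c.M) * c.α₀ * (1 + D.dj X) := fun X =>
    add_pos_of_pos_of_nonneg (by linarith) (hqd X)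
  have hh : ∀ X, 0 < (min (1 / 8) (a / 2) - c.α₁) / (2 * c.α₁ + c₀ * ((c.L : ℝ) * c.M) * c.α₀ * (1 + D.dj X)) :=
    fun X => div_pos hm (hden X)
  have hH : ∀ X, ((min (1 / 8) (a / 2) - c.α₁) / (2 * c.α₁ + c₀ * ((c.L : ℝ) * c.M) * c.α₀ * (1 + D.dj X)))⁻¹ ≤
      (c.α₁ + c₀ * ((c.L : ℝ) * c.M) * c.α₀) / ((min (1 / 8) (a / 2) - c.α₁) / 2) * (1 + D.dj X) := by
    intro X
    have h1 : ((min (1 / 8) (a / 2) - c.α₁) /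
        (2 * c.α₁ + c₀ * ((c.L : ℝ) * c.M) * c.α₀ * (1 + D.dj X)))⁻¹ ≤
        (2 * c.α₁ + c₀ * ((c.L : ℝ) * c.M) * c.α₀) / (min (1 / 8) (a / 2) - c.α₁) * (1 + D.dj X) :=
      inv_halfWidth_le hm (by linarith) (D.dj_nonneg X)
    have h2 : (2 * c.α₁ + c₀ * ((c.L : ℝ) * c.M) * c.α₀) / (min (1 / 8) (a / 2) - c.α₁)
        ≤ (c.α₁ + c₀ * ((c.L : ℝ) * c.M) * c.α₀) / ((min (1 / 8) (a / 2) - c.α₁) / 2) := by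
      rw [div_div_eq_mul_div]
      exact div_le_div_of_nonneg_right (by linarith) hm.le
    exact h1.trans (mul_le_mul_of_nonneg_right h2 (by linarith [D.dj_nonneg X]))
  have hdom : LineInStrip sp' sp (expLine gen base)
      (fun X => (min (1 / 8) (a / 2) - c.α₁) / (2 * c.α₁ + c₀ * ((c.L : ℝ) * c.M) * c.α₀ * (1 + D.dj X))) :=
    lineInStrip_expLine_cplx (κ := fun X => c₀ * ((c.L : ℝ) * c.M) * c.α₀ * (1 + D.dj X)) hα₁.le hα₁a hqd hden
      hsplit hbase hsp
  have han : AnalyticOnStrip sp' E (expLine gen base)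
      (fun X => (min (1 / 8) (a / 2) - c.α₁) / (2 * c.α₁ + c₀ * ((c.L : ℝ) * c.M) * c.α₀ * (1 + D.dj X))) :=
    analyticOnStrip_expLine hE hdom
  have hres := logHalfBound_secondOrder_of_R21 c h21 hLM hα₀ hα₁.le hA hh hH hdom han h0 hEb
  have heq : 16 * A * (1 + c₀ ^ 2) / ((min (1 / 8) (a / 2) - c.α₁) / 2) ^ 2 =
      64 * A * (1 + c₀ ^ 2) / (min (1 / 8) (a / 2) - c.α₁) ^ 2 := by
    field_simp
    ring
  rw [heq] at hres
  exact hres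

/-- **(I.1.18) for the differenced pieces with an L, M-INDEPENDENT constant, complex background**:
`B10Eq61PerSite.bound118_secondOrder_of_R21` along complex-background exponential lines — constant
`(64A(1 + c₀²)/(min(1/8, a/2) − α₁)²)·c₁`, rate `r − 3`; same remaining binders plus the volume bound.
[cite: Balaban1988RG2Cluster, p.21 (closing paragraph); Balaban1985UV3, (29) p.263, p.272; Balaban1987RG1, (1.12)–(1.13) p.262] -/
theorem bound118_secondOrder_expLine_cplx_of_R21 (c : B13.Consts) (h21 : c.R21)
    (hLM : 1 ≤ (c.L : ℝ) * c.M) (hα₀ : 0 ≤ c.α₀) (hα₁ : 0 < c.α₁) {A a c₀ r c₁ : ℝ} (hA : 0 ≤ A)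
    (hc₀ : 0 ≤ c₀) (hα₁a : c.α₁ < min (1 / 8) (a / 2))
    (hsplit : ∀ X φ, φ ∈ sp' X → ∀ b, ∃ S ∈ skewAdjoint 𝔸,
      ‖S‖ ≤ c₀ * ((c.L : ℝ) * c.M) * c.α₀ * (1 + D.dj X) ∧ ‖gen X φ b - S‖ ≤ c.α₁)
    (hbase : ∀ X φ, φ ∈ sp' X → ∀ b, base X φ b ∈ unitary 𝔸) (hsp : ∀ X, TubeCfg ι 𝔸 a ⊆ sp X)
    (hE : ∀ X, DifferentiableOn ℂ (E X) (sp X)) (h0 : DerivZeroAlongV sp' E (expLine gen base))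
    (hEb : B13.LogHalfBound D sp E nX (A * ((c.L : ℝ) * c.M) ^ 4) r) (hvol : B13.VolBoundK1 D nX c₁)
    (hc₁ : 0 ≤ c₁) :
    B13.Bound118 D sp' (diffAlongV E (expLine gen base))
      (64 * A * (1 + c₀ ^ 2) / (min (1 / 8) (a / 2) - c.α₁) ^ 2 * c₁) (r - 3) := by
  have hLM0 : 0 ≤ (c.L : ℝ) * c.M := zero_le_one.trans hLM
  have hq : 0 ≤ c₀ * ((c.L : ℝ) * c.M) * c.α₀ := mul_nonneg (mul_nonneg hc₀ hLM0) hα₀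
  have hm : 0 < min (1 / 8) (a / 2) - c.α₁ := by linarith
  have hqd : ∀ X, 0 ≤ c₀ * ((c.L : ℝ) * c.M) * c.α₀ * (1 + D.dj X) := fun X =>
    mul_nonneg hq (by linarith [D.dj_nonneg X])
  have hden : ∀ X, 0 < 2 * c.α₁ + c₀ * ((c.L : ℝ) * c.M) * c.α₀ * (1 + D.dj X) := fun X =>
    add_pos_of_pos_of_nonneg (by linarith) (hqd X)
  have hh : ∀ X, 0 < (min (1 / 8) (a / 2) - c.α₁) / (2 * c.α₁ + c₀ * ((c.L : ℝ) * c.M) * c.α₀ * (1 + D.dj X)) :=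
    fun X => div_pos hm (hden X)
  have hH : ∀ X, ((min (1 / 8) (a / 2) - c.α₁) / (2 * c.α₁ + c₀ * ((c.L : ℝ) * c.M) * c.α₀ * (1 + D.dj X)))⁻¹ ≤
      (c.α₁ + c₀ * ((c.L : ℝ) * c.M) * c.α₀) / ((min (1 / 8) (a / 2) - c.α₁) / 2) * (1 + D.dj X) := by
    intro X
    have h1 : ((min (1 / 8) (a / 2) - c.α₁) /
        (2 * c.α₁ + c₀ * ((c.L : ℝ) * c.M) * c.α₀ * (1 + D.dj X)))⁻¹ ≤
        (2 * c.α₁ + c₀ * ((c.L : ℝ) * c.M) * c.α₀) / (min (1 / 8) (a / 2) - c.α₁) * (1 + D.dj X) :=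
      inv_halfWidth_le hm (by linarith) (D.dj_nonneg X)
    have h2 : (2 * c.α₁ + c₀ * ((c.L : ℝ) * c.M) * c.α₀) / (min (1 / 8) (a / 2) - c.α₁)
        ≤ (c.α₁ + c₀ * ((c.L : ℝ) * c.M) * c.α₀) / ((min (1 / 8) (a / 2) - c.α₁) / 2) := by
      rw [div_div_eq_mul_div]
      exact div_le_div_of_nonneg_right (by linarith) hm.le
    exact h1.trans (mul_le_mul_of_nonneg_right h2 (by linarith [D.dj_nonneg X]))
  have hdom : LineInStrip sp' sp (expLine gen base)
      (fun X => (min (1 / 8) (a / 2) - c.α₁) / (2 * c.α₁ + c₀ * ((c.L : ℝ) * c.M) * c.α₀ * (1 + D.dj X))) :=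
    lineInStrip_expLine_cplx (κ := fun X => c₀ * ((c.L : ℝ) * c.M) * c.α₀ * (1 + D.dj X)) hα₁.le hα₁a hqd hden
      hsplit hbase hsp
  have han : AnalyticOnStrip sp' E (expLine gen base)
      (fun X => (min (1 / 8) (a / 2) - c.α₁) / (2 * c.α₁ + c₀ * ((c.L : ℝ) * c.M) * c.α₀ * (1 + D.dj X))) :=
    analyticOnStrip_expLine hE hdom
  have hres := bound118_secondOrder_of_R21 c h21 hLM hα₀ hα₁.le hA hh hH hdom han h0 hEb hvol hc₁
  have heq : 16 * A * (1 + c₀ ^ 2) / ((min (1 / 8) (a / 2) - c.α₁) / 2) ^ 2 * c₁ =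
      64 * A * (1 + c₀ ^ 2) / (min (1 / 8) (a / 2) - c.α₁) ^ 2 * c₁ := by
    congr 1
    field_simp
    ring
  rw [heq] at hres
  exact hres

variable {Λ : Type*} {base₀ : D.Dom → ι → 𝔸}

/-- **JOIN WITH THE b13 LINEAGE'S (L3′)** (`B10Eq61Leaves.derivZeroAlongV_expLine_of_mem_closure` — invariance of the
terms under chart-linear symmetries + the generator configuration in the closed span of the symmetry generators'
ranges; that theorem never asked the generator to be skew-adjoint, so it serves complex backgrounds verbatim): every
leaf of `B10Eq61PerSite.logHalfBound_diffAlongV_of_derivZero` supplied along complex-background exponential lines,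
generic letters — constant `8·((2p + q)/(min(1/8, a/2) − p))²·B`, rate `r − 2`.
[cite: Balaban1985UV3, (26), (28)–(29) p.263, (31)–(32) p.264, (61) p.271, p.272; Balaban1987RG1, (1.12)–(1.13) p.262] -/
theorem logHalfBound_expLine_cplx_of_mem_closure {B r a p q : ℝ} (hp : 0 ≤ p) (hq : 0 ≤ q) (hpq : 0 < p + q)
    (hpa : p < min (1 / 8) (a / 2)) (hB : 0 ≤ B)
    (hsplit : ∀ X φ, φ ∈ sp' X → ∀ b, ∃ S ∈ skewAdjoint 𝔸,
      ‖S‖ ≤ q * (1 + D.dj X) ∧ ‖gen X φ b - S‖ ≤ p)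
    (hbase : ∀ X b, base₀ X b ∈ unitary 𝔸) (hsp : ∀ X, TubeCfg ι 𝔸 a ⊆ sp X)
    (hE : ∀ X, DifferentiableOn ℂ (E X) (sp X))
    (T : Λ → ℝ → (ι → 𝔸) →L[ℂ] (ι → 𝔸)) (L : Λ → (ι → 𝔸) →L[ℂ] (ι → 𝔸)) (α : D.Dom → ℝ) (hα : ∀ X, 0 < α X)
    (hTd : ∀ l w, HasDerivAt (fun t => T l t w) (L l w) 0)
    (hinv : ∀ X l t, ∀ v ∈ ball (0 : ι → 𝔸) (α X), T l t v ∈ ball (0 : ι → 𝔸) (α X) →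
      E X (expChart base₀ X (T l t v)) = E X (expChart base₀ X v))
    (hmem : ∀ X φ, φ ∈ sp' X → gen X φ ∈ closure (Submodule.span ℂ (⋃ l, Set.range (L l)) : Set (ι → 𝔸)))
    (hEb : B13.LogHalfBound D sp E nX B r) :
    B13.LogHalfBound D sp' (diffAlongV E (expLine gen (fun X _ => base₀ X))) nX
      (8 * ((2 * p + q) / (min (1 / 8) (a / 2) - p)) ^ 2 * B) (r - 2) :=
  have ha : 0 < a := by have := min_le_right (1 / 8 : ℝ) (a / 2); linarith
  logHalfBound_expLine_cplx_of_derivZero hp hq hpq hpa hB hsplit (fun X _ _ b => hbase X b) hsp hE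
    (derivZeroAlongV_expLine_of_mem_closure ha hbase hsp hE T L α hα hTd hinv hmem) hEb

/-- **(I.1.18) FOR THE DIFFERENCED (61)-PIECES ALONG COMPLEX BACKGROUNDS, L, M-INDEPENDENT CONSTANT, ALL THREE
LEAVES SUPPLIED** ([II]'s letters, printed R21, `α₁ < min(1/8, a/2)`): constant `(64A(1 + c₀²)/(min(1/8, a/2) − α₁)²)·c₁`,
rate `r − 3`. [cite: Balaban1988RG2Cluster, pp.15, 20–21; Balaban1985UV3, (26), (29), (31)–(32) pp.263–264, (61) p.271, p.272; Balaban1987RG1, (1.12)–(1.13) p.262] -/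
theorem bound118_secondOrder_expLine_cplx_of_mem_closure (c : B13.Consts) (h21 : c.R21)
    (hLM : 1 ≤ (c.L : ℝ) * c.M) (hα₀ : 0 ≤ c.α₀) (hα₁ : 0 < c.α₁) {A a c₀ r c₁ : ℝ} (hA : 0 ≤ A)
    (hc₀ : 0 ≤ c₀) (hα₁a : c.α₁ < min (1 / 8) (a / 2))
    (hsplit : ∀ X φ, φ ∈ sp' X → ∀ b, ∃ S ∈ skewAdjoint 𝔸,
      ‖S‖ ≤ c₀ * ((c.L : ℝ) * c.M) * c.α₀ * (1 + D.dj X) ∧ ‖gen X φ b - S‖ ≤ c.α₁)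
    (hbase : ∀ X b, base₀ X b ∈ unitary 𝔸) (hsp : ∀ X, TubeCfg ι 𝔸 a ⊆ sp X)
    (hE : ∀ X, DifferentiableOn ℂ (E X) (sp X))
    (T : Λ → ℝ → (ι → 𝔸) →L[ℂ] (ι → 𝔸)) (L : Λ → (ι → 𝔸) →L[ℂ] (ι → 𝔸)) (α : D.Dom → ℝ) (hα : ∀ X, 0 < α X)
    (hTd : ∀ l w, HasDerivAt (fun t => T l t w) (L l w) 0)
    (hinv : ∀ X l t, ∀ v ∈ ball (0 : ι → 𝔸) (α X), T l t v ∈ ball (0 : ι → 𝔸) (α X) →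
      E X (expChart base₀ X (T l t v)) = E X (expChart base₀ X v))
    (hmem : ∀ X φ, φ ∈ sp' X → gen X φ ∈ closure (Submodule.span ℂ (⋃ l, Set.range (L l)) : Set (ι → 𝔸)))
    (hEb : B13.LogHalfBound D sp E nX (A * ((c.L : ℝ) * c.M) ^ 4) r) (hvol : B13.VolBoundK1 D nX c₁)
    (hc₁ : 0 ≤ c₁) :
    B13.Bound118 D sp' (diffAlongV E (expLine gen (fun X _ => base₀ X)))
      (64 * A * (1 + c₀ ^ 2) / (min (1 / 8) (a / 2) - c.α₁) ^ 2 * c₁) (r - 3) :=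
  have ha : 0 < a := by have := min_le_right (1 / 8 : ℝ) (a / 2); linarith
  bound118_secondOrder_expLine_cplx_of_R21 c h21 hLM hα₀ hα₁ hA hc₀ hα₁a hsplit (fun X _ _ b => hbase X b) hsp hE
    (derivZeroAlongV_expLine_of_mem_closure ha hbase hsp hE T L α hα hTd hinv hmem) hEb hvol hc₁

end secondOrder

/-! ## §7. NON-VACUITY: (a) a joint instance of §6 with a NON-ZERO complex part (`𝔸 = ℂ`, `p = 1/16`); (b) a genuinely
NON-COMMUTING instance of §3 in `M₂(ℂ)`, uniform in the size of the skew part -/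

section examples

/-- (L3′) for the example family `E φ = (φ − 1)²` of `…B10Eq29TubeLine` §6 along the exponential line of ANY generator
with base point `1`: `d/dζ (exp(ζg) − 1)² |_{ζ=0} = 2(e⁰ − 1)·g = 0`. [folklore] -/
theorem derivZeroAlongV_exE (gen : unitSys.Dom → (Unit → ℂ) → Unit → ℂ) (sp' : unitSys.Dom → Set (Unit → ℂ)) :
    DerivZeroAlongV sp' exE (expLine gen exBase) := by
  intro X φ _
  have h1 : HasDerivAt (fun ζ : ℂ => exp (ζ • gen X φ ()) * exBase X φ ())
      (exp ((0 : ℂ) • gen X φ ()) * gen X φ () * exBase X φ ()) 0 :=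
    (hasDerivAt_exp_smul_const (gen X φ ()) 0).mul_const _
  have h2 : HasDerivAt (fun ζ : ℂ => (exp (ζ • gen X φ ()) * exBase X φ () - 1) ^ 2)
      (((2 : ℕ) : ℂ) * (exp ((0 : ℂ) • gen X φ ()) * exBase X φ () - 1) ^ (2 - 1) *
        (exp ((0 : ℂ) • gen X φ ()) * gen X φ () * exBase X φ ())) 0 :=
    (h1.sub_const 1).pow 2
  show deriv (fun ζ : ℂ => (exp (ζ • gen X φ ()) * exBase X φ () - 1) ^ 2) 0 = 0
  rw [h2.deriv]
  simp [exBase]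

/-- Example generator with a NON-ZERO complex part: `(min ‖φ‖ 1)·i + 1/16` (skew part of norm `≤ 1`, "Hermitian" part
`1/16`). [folklore] -/
def exGenC (X : unitSys.Dom) (φ : Unit → ℂ) (b : Unit) : ℂ := exGen X φ b + (16 : ℂ)⁻¹

/-- The split hypothesis of §5/§6 for the example generator: within `1/16` of the skew element `exGen` of norm
`≤ 1·(1 + d)`. [folklore] -/
theorem exGenC_split (X : unitSys.Dom) (φ : Unit → ℂ) (b : Unit) :
    ∃ S ∈ skewAdjoint ℂ, ‖S‖ ≤ 1 * (1 + unitSys.dj X) ∧ ‖exGenC X φ b - S‖ ≤ 1 / 16 :=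
  ⟨exGen X φ b, exGen_mem_skewAdjoint X φ b, by simpa [unitSys] using norm_exGen_le X φ b, by simp [exGenC]⟩

/-- **Joint non-vacuity of §6 (generic letters) with the `p`-slot EXERCISED**: `𝔸 = ℂ`, one bond, generator `exGenC`
(`p = 1/16`, `q = 1`), base `1`, `E φ = (φ − 1)²`, analyticity space = the bondwise tube of half-width `a = 1` (on which
`‖E‖ ≤ 16`, `…B10Eq29TubeLine.example_logHalfBound_exE`), evaluation space = everything: every binder of
`logHalfBound_expLine_cplx_of_derivZero` holds and it yields the differenced bound with constant
`8·((2/16 + 1)/(1/8 − 1/16))²·16`. [folklore] -/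
theorem example_logHalfBound_expLine_cplx :
    B13.LogHalfBound unitSys (fun _ => univ) (diffAlongV exE (expLine exGenC exBase)) (fun _ => 1)
      (8 * ((2 * (1 / 16) + 1) / (min (1 / 8) (1 / 2) - 1 / 16)) ^ 2 * 16) (0 - 2) :=
  logHalfBound_expLine_cplx_of_derivZero (sp := fun _ => TubeCfg Unit ℂ 1) (a := 1) (q := 1) (by norm_num)
    zero_le_one (by norm_num) (lt_min (by norm_num) (by norm_num)) (by norm_num)
    (fun X φ _ b => exGenC_split X φ b) (fun _ _ _ _ => by simp [exBase]) (fun _ => Subset.rfl)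
    (fun X => (differentiable_exE X).differentiableOn) (derivZeroAlongV_exE exGenC _) example_logHalfBound_exE

/-- …and non-degenerately: the differenced family at the configuration `0` is `(exp(1/16) − 1)² ≠ 0`. [folklore] -/
theorem example_diffAlongV_exGenC (X : unitSys.Dom) :
    diffAlongV exE (expLine exGenC exBase) X (fun _ => 0) ≠ 0 := by
  have h1 : diffAlongV exE (expLine exGenC exBase) X (fun _ => 0) = (exp ((16 : ℂ)⁻¹) - 1) ^ 2 := by
    simp [diffAlongV, expLine, exE, exGenC, exGen, exBase]
  rw [h1]
  refine pow_ne_zero 2 (sub_ne_zero.2 ?_)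
  rw [← congr_fun Complex.exp_eq_exp_ℂ, show ((16 : ℂ)⁻¹) = ((16⁻¹ : ℝ) : ℂ) by push_cast; ring,
    ← Complex.ofReal_exp, ← Complex.ofReal_one, Ne, Complex.ofReal_inj]
  exact (Real.one_lt_exp_iff.2 (by norm_num)).ne'

open scoped Matrix.Norms.L2Operator

/-- `J = E₁₂ − E₂₁ ∈ 𝔰𝔲(2)` (skew-Hermitian; the "real potential" direction of the example). [folklore] -/
def mJ : Matrix (Fin 2) (Fin 2) ℂ := Matrix.of ![![0, 1], ![-1, 0]]

/-- `σₓ = E₁₂ + E₂₁` (Hermitian AND unitary; the "complex part" direction of the example). [folklore] -/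
def mX : Matrix (Fin 2) (Fin 2) ℂ := Matrix.of ![![0, 1], ![1, 0]]

/-- `J` is skew-Hermitian. [folklore] -/
theorem mJ_mem_skewAdjoint : mJ ∈ skewAdjoint (Matrix (Fin 2) (Fin 2) ℂ) := by
  rw [skewAdjoint.mem_iff, Matrix.star_eq_conjTranspose]
  ext i j
  fin_cases i <;> fin_cases j <;> simp [mJ, Matrix.conjTranspose_apply]

/-- `σₓ ∈ U(2)`. [folklore] -/
theorem mX_mem_unitary : mX ∈ unitary (Matrix (Fin 2) (Fin 2) ℂ) := by
  rw [Unitary.mem_iff, Matrix.star_eq_conjTranspose]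
  constructor <;>
  · ext i j
    fin_cases i <;> fin_cases j <;>
      simp [mX, Matrix.mul_apply, Fin.sum_univ_two, Matrix.conjTranspose_apply]

/-- `J` and `σₓ` do NOT commute — the commuting factorization of `…B10Eq29TubeLine` §1 is unavailable. [folklore] -/
theorem mJ_mul_mX_ne : mJ * mX ≠ mX * mJ := by
  intro h
  have h00 := congr_fun (congr_fun h 0) 0
  norm_num [mJ, mX, Matrix.mul_apply, Fin.sum_univ_two] at h00

/-- **Non-commuting non-vacuity of §3, UNIFORM in the skew part**: in `M₂(ℂ)` with the operator norm (structure
`…B10Eq29TubeLine.cstarAlgebraMatrix 2`, threaded by `letI`), for EVERY real `θ` the element `exp(θJ + σₓ/8)` lies in the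
tube of half-width `1/4` around `U(2)` — although `‖θJ + σₓ/8‖ → ∞`; the one-exponent reading `exp(B)·1`, `B = θJ + σₓ/8`
would need half-width `> ‖B‖`. [folklore] -/
theorem example_exp_add_mem_tube_m2 (θ : ℝ) :
    letI := cstarAlgebraMatrix 2
    exp ((θ : ℂ) • mJ + (8 : ℂ)⁻¹ • mX) ∈ Tube (Matrix (Fin 2) (Fin 2) ℂ) (1 / 4) := by
  letI := cstarAlgebraMatrix 2
  have hS : (θ : ℂ) • mJ ∈ skewAdjoint (Matrix (Fin 2) (Fin 2) ℂ) := ofReal_smul_mem_skewAdjoint mJ_mem_skewAdjoint θ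
  have hT : ‖(8 : ℂ)⁻¹ • mX‖ = 1 / 8 := by
    rw [norm_smul, norm_inv, CStarRing.norm_of_mem_unitary mX_mem_unitary]
    norm_num
  exact exp_add_mem_tube hS (by norm_num) hT.le (by rw [hT]; norm_num)

end examples

end Literature.MathematicalPhysics.QuantumFieldTheory.Balaban1983to89.B10Eq29CplxLine
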